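import Summits.BirchSwinnertonDyer.BirchSwinnertonDyer.Theorems.AdditiveKolyvaginRoadLagrangianSwitchAtPLines
import Summits.BirchSwinnertonDyer.Rank1Residual.GaloisImage.PropagatedConditionCount
import HarnessLib

/-!
# Route `AdditiveKolyvaginRoad`, crux `LevelKolyvaginSystemsAdditive` (item stmt-BirchSwinnertonDyer-21396, KS′):
# THE ONE-PLACE LAGRANGIAN SWITCH AT `p`, POITOU–TATE DISCHARGED — two distinct Lagrangian lines at one place move the
# Selmer order by EXACTLY a factor `p` — (T-A1p) of `Cruxes/LevelKolyvaginSystemsAdditive/SOCKETS-TRANSFER.md`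
# (cell `pub/bsd-wall`, width seat `bsd-wall-akr-p2x-w2` g3; `--supports stmt-BirchSwinnertonDyer-21396`, helper; sequel of
# `…LagrangianSwitchAtPJump.lean` (p596759) and `…LagrangianSwitchAtPLines.lean`)

WHY. The transfer-type lines on KS′ (TRIAGE-r1 survivor A: `depleted-shadow-transfer` ⊕ `pold-fusion-glue` ⊕ `epsilon-matched-retyping`)
borrow a congruent lender's level system; their stub (A1) «E's Kummer LINE at `p` = the transported Kummer line of the lender» is
decided by a one-place switch: if the two lines differed, the two Selmer groups (same local conditions off `p`) would have
dimensions of DIFFERENT parity, contradicting `p`-parity for both and equal global root numbers. w3 g0 proved the switch as pure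
linear algebra (`…LagrangianSwitch.lean`: plane + two isotropic lines + isotropic non-zero image); `SOCKETS-TRANSFER.md` and
`ESIDE-CLOSED.md` §2 list its Poitou–Tate inputs AT THE PLACE `p` as «(T-A1p), not built». This file builds them and states the
switch directly on the tree's Selmer structures, over ANY number field (so over `ℚ`, where TRIAGE-r1-1 §5 says it must run: over
the Heegner field the two places above the split `p` are swapped by complex conjugation and the parity change is even).

WHAT (namespace `…Theorems.AdditiveKoly.LagrangianSwitchAtP`, `W` an elliptic curve over a number field `K`, level written `p ^ 1`
as in the carrier's `Vp W K p`). Parts §1–§3 are the companion file `…LagrangianSwitchAtPLines.lean`: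
* §1 `eq_or_eq_of_isotropic_of_card_eq` — pure group theory: in a group of order `q²` (`q` an odd prime) with a symmetric
  `ℤ/q`-valued pairing of trivial kernel, two DISTINCT isotropic subgroups of order `q` carry every isotropic subgroup of order `q`
  (`H = ℤk ⊕ ℤl`, `b(ik + jl, ik + jl) = 2ij·b(k,l)` with `b(k,l) ≠ 0`); the additive-group form of w3 g0's
  `LagrangianSwitch.mem_span_or_mem_span_of_isotropic`.
* §2 `invWeilPairing_symm` (the local cup-product pairing `inv_v(· ∪ₑ ·)` is symmetric, any curve over `K`; akr-p2x g0's
  `invWeilPairing_comm` was for a base change from `ℚ`), `invWeilPairing_localization_eq_zero_of_mem_relaxed` (POITOU–TATE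
  RECIPROCITY at one place: the image at `v₀` of the `v₀`-relaxed Selmer group is ISOTROPIC — the other local terms vanish by the
  isotropy of the Kummer conditions), `selmerGroup_update_eq` ∕ `selmerGroup_kummerStrict_eq` (the Selmer groups of `𝓚[v₀ ↦ D]`
  and of the strict structure as cuts of the relaxed group).
* §3 subgroup bookkeeping (`#f(G) = [G : G ∩ ker f]`, cutting by a line containing resp. meeting trivially the image).
* §4 **`natCard_selmerGroup_switch`** — for `p ≠ 2`, a Weil pairing `e`, a Poitou–Tate family `inv` (`IsPerfect`,
  `SumLocalTermEqZero`, `SelmerComplement` = DUAL.2), a finite place `w₀` with `#H¹(K_{w₀}, E[p]) = p²` (PLANE), and a local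
  condition `L′` at `w₀` isotropic for `inv_{w₀}(· ∪ₑ ·)`, non-zero and `≠ 𝓚_{w₀}`:
  `#H¹_𝓚(K, E[p]) = p · #H¹_{𝓚[w₀ ↦ L′]}(K, E[p])` OR `#H¹_{𝓚[w₀ ↦ L′]} = p · #H¹_𝓚` (the `𝔽_p`-dimensions differ by exactly
  one). Ingredients: the JUMP `[relaxed : strict] = p` (jump file §4), isotropy of the image (§2), the orders `#𝓚_{w₀} = #L′ = p`
  (Lagrangian count of the jump file §2, incl. real places for odd `p`; isotropy + `L′ ≠ 0`), and §1.
* §5 `natCard_selmerGroup_switch_of_poitouTate` (the same from the NAMED fact `poitouTate_selmerStructure_duality K` and the proved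
  `exists_weilPairing_holds`, isotropy of `L′` asked for every family ∕ pairing), **`eq_kummer_of_isotropic_of_even_iff`** (the
  (A1)-shape contrapositive: if the two Selmer orders are `p^a`, `p^b` with `a ≡ b (mod 2)` then `L′ = 𝓚_{w₀}`), `natCard_localH1_eq_sq` (PLANE count
  `#H¹(K_v, E[p]) = p²` from `E(K_v)[p] = 0` and `#(𝓞_v/p) = p`, Tate's local Euler characteristic, PROVED in the tree) and
  `natCard_localH1_rat_eq_sq` (`K = ℚ`, `v = (p)`: `E(ℚ_p)[p] = 0` suffices — automatic off Kodaira II∕III on additive cells,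
  decidable per curve: TRIAGE-r1-2 (G3-4), Q-LOC5T).

HOW A TRANSFER LINE USES IT (not done here): with `L′ := θ(𝓚^{lender}_{p})` for a `Γ_ℚ`-isomorphism `θ : E₀[p] ≅ E[p]` compatible
with the Weil pairings, `𝓚[p ↦ L′]` is the transported Selmer structure of the lender once (θK) holds at every `v ≠ p` (w3 g2's
`…LevelSystemsCongruence`); `p`-parity for `E` and for the lender (Dokchitser–Dokchitser ∕ Nekovář) + `w(E) = w(lender)` make both
`𝔽_p`-dimensions of the same parity, so the conclusion here REFUTES `L′ ≠ 𝓚_p`: the Kummer lines at `p` agree ((θK) at `p`).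

HONEST FRAMING: theorems only; 0 definitions, 0 named facts, 0 `sorry`; CONDITIONAL on the displayed Poitou–Tate family ∕ named
fact (the route's DUAL.2) and the displayed local hypotheses; E-side glue; closes nothing. The crux's open content ((T-A2) transfer of
Heegner classes at conductor `m > 1`, K1 at `p²`-level, the seed) is untouched. BSD is not proved by any of this.

References: [cite: PoonenRains2012, Prop. 4.10, Prop. 4.11] [cite: McCallumLMS1991, Prop. 2.1 (p. 296)] [cite: MilneADT2006, Ch. I,
Cor. 2.3, Thm. 2.8, Lemma 3.3, Rem. 3.7, Thm. 4.10, Lemma 6.15] [cite: NeukirchSchmidtWingberg2008, I §4 Prop. 1.4.4]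
[cite: DokchitserDokchitserAnnals2010, Thm. 1.4] [cite: WZhang2014, Lemma 5.3].
-/

-- single-conjunct summit: `Summit.BirchSwinnertonDyer.BirchSwinnertonDyer.…` repeats the name by design
set_option linter.dupNamespace false

noncomputable section

open scoped Classical NumberField
open Function NumberField IsDedekindDomain Field WeierstrassCurve
open Literature.NumberTheory.EllipticCurves
open Literature.NumberTheory.GaloisRepresentations Literature.NumberTheory.GaloisRepresentations.DiscreteGaloisModule
  Literature.NumberTheory.GaloisCohomology
open Summit.BirchSwinnertonDyer.Rank1Residual.X11b.FiniteDuality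
open Summit.BirchSwinnertonDyer.Rank1Residual.X11b.Relaxation
open Summit.BirchSwinnertonDyer.Rank1Residual.X11b.LocBridge
open Summit.BirchSwinnertonDyer.Rank1Residual.X11b
open Summit.BirchSwinnertonDyer.Rank1Residual.GaloisImage
open Summit.BirchSwinnertonDyer.Rank1Residual.X11b.Three.Koly.ZhangSupply
open Summit.BirchSwinnertonDyer.Rank1Residual.X11b.KummerPT

namespace Summit.BirchSwinnertonDyer.BirchSwinnertonDyer.Theorems.AdditiveKoly.LagrangianSwitchAtP

variable {K : Type} [Field K] [NumberField K] (W : WeierstrassCurve K) [W.IsElliptic]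

/-! ## §4 (this file) THE ONE-PLACE LAGRANGIAN SWITCH at a finite place, Poitou–Tate discharged -/

section Switch

variable (p : ℕ) [Fact p.Prime]
variable (e : W.geomTorsion ((p ^ 1 : ℕ) : ℤ) → W.geomTorsion ((p ^ 1 : ℕ) : ℤ) → AlgebraicClosure K)
  (hμ : ∀ S T, e S T ^ (p ^ 1) = 1)
  (hadd₁ : ∀ S₁ S₂ T, e (S₁ + S₂) T = e S₁ T * e S₂ T)
  (hadd₂ : ∀ S T₁ T₂, e S (T₁ + T₂) = e S T₁ * e S T₂)
  (hgal : ∀ (σ : absoluteGaloisGroup K) (S T : W.geomTorsion ((p ^ 1 : ℕ) : ℤ)), σ • e S T = e (σ • S) (σ • T))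
  (halt : ∀ T, e T T = 1) (hnondeg : ∀ T, (∀ S, e S T = 1) → T = 0)
  (inv : LocalInvariants K (p ^ 1))

include halt hnondeg in
/-- **THE ONE-PLACE LAGRANGIAN SWITCH, Poitou–Tate discharged.** `E = W` an elliptic curve over ANY number field `K`, `p ≠ 2`,
a Weil pairing `e` on `E[p]`, a Poitou–Tate family `inv` at level `p` (`IsPerfect`, `SumLocalTermEqZero`, `SelmerComplement`:
the content of DUAL.2 `poitouTate_selmerStructure_duality K`), a finite place `w₀` at which `H¹(K_{w₀}, E[p])` is a PLANE
(`#H¹(K_{w₀}, E[p]) = p²`; at `w₀ ∣ p`: `E(K_{w₀})[p] = 0` and `[K_{w₀} : ℚ_p] = 1`), and a local condition `L′` at `w₀` which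
is ISOTROPIC for `inv_{w₀}(· ∪ₑ ·)`, non-zero and DIFFERENT from E's Kummer condition `𝓚_{w₀}`. Then the Selmer groups of
`𝓚` (E's `p`-Selmer group) and of `𝓚[w₀ ↦ L′]` (E's Kummer condition at every place `≠ w₀`, `L′` at `w₀`) satisfy
`#H¹_𝓚 = p · #H¹_{𝓚[w₀ ↦ L′]}` OR `#H¹_{𝓚[w₀ ↦ L′]} = p · #H¹_𝓚` — their `𝔽_p`-dimensions differ by EXACTLY ONE.
Proof: the image `Λ` at `w₀` of the `w₀`-relaxed Selmer group has order `[relaxed : strict] = p` (JUMP,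
`relIndex_kummerStrict_kummerRelaxed_sq`) and is ISOTROPIC (Poitou–Tate reciprocity, §2); `𝓚_{w₀}` and `L′` are isotropic
LINES (Lagrangian count, jump file §2 ∕ isotropy); two distinct isotropic lines of the non-degenerate symmetric plane carry every
isotropic line (§1), so `Λ = 𝓚_{w₀}` or `Λ = L′`, and the line met trivially cuts the relaxed group down to the strict one.
With p-PARITY for both structures and equal global root numbers this FORBIDS `L′ ≠ 𝓚_{w₀}` — the (A1) «Kummer line of `E` at
`p` = transported Kummer line of the congruent lender» of the transfer lines on KS′ (TRIAGE-r1-1 §5: run it over `ℚ`).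
[cite: PoonenRains2012, Prop. 4.10, Prop. 4.11] [cite: MilneADT2006, Ch. I, Cor. 2.3, Thm. 2.8, Thm. 4.10]
[cite: McCallumLMS1991, Prop. 2.1] -/
theorem natCard_selmerGroup_switch
    -- cup products need the compactness of the local absolute Galois groups (binder, discharged by
    -- `absoluteGaloisGroup_compactSpace` at the call site)
    [∀ v : Place K, CompactSpace (absoluteGaloisGroup (Place.Completion v))]
    [Finite (W.geomTorsion ((p ^ 1 : ℕ) : ℤ))]
    (hp2 : p ≠ 2) (hperf : inv.IsPerfect) (hsum : inv.SumLocalTermEqZero) (hcompl : inv.SelmerComplement)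
    (w₀ : HeightOneSpectrum (𝓞 K))
    (hH : Nat.card (galoisCohomology ((W.torsionGaloisModule ((p ^ 1 : ℕ) : ℤ)).toLocal (Sum.inr w₀ : Place K)) 1) = p ^ 2)
    (L : AddSubgroup (galoisCohomology ((W.torsionGaloisModule ((p ^ 1 : ℕ) : ℤ)).toLocal (Sum.inr w₀ : Place K)) 1))
    (hLiso : ∀ x ∈ L, ∀ y ∈ L, invWeilPairing W (p ^ 1) e hμ hadd₁ hadd₂ hgal inv (Sum.inr w₀) x y = 0)
    (hL0 : L ≠ ⊥) (hLK : L ≠ W.kummerSelmerStructure ((p ^ 1 : ℕ) : ℤ) (Sum.inr w₀)) :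
    Nat.card (W.kummerSelmerStructure ((p ^ 1 : ℕ) : ℤ)).selmerGroup =
        p * Nat.card (SelmerStructure.selmerGroup (Function.update (W.kummerSelmerStructure ((p ^ 1 : ℕ) : ℤ))
          (Sum.inr w₀) L : SelmerStructure (W.torsionGaloisModule ((p ^ 1 : ℕ) : ℤ)))) ∨
      Nat.card (SelmerStructure.selmerGroup (Function.update (W.kummerSelmerStructure ((p ^ 1 : ℕ) : ℤ))
          (Sum.inr w₀) L : SelmerStructure (W.torsionGaloisModule ((p ^ 1 : ℕ) : ℤ)))) =
        p * Nat.card (W.kummerSelmerStructure ((p ^ 1 : ℕ) : ℤ)).selmerGroup := by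
  have hp : p.Prime := Fact.out
  haveI : NeZero (p ^ 1 : ℕ) := ⟨pow_ne_zero 1 hp.ne_zero⟩
  have hp1 : IsPrimePow (p ^ 1 : ℕ) := hp.isPrimePow.pow one_ne_zero
  have hodd : Odd (p ^ 1 : ℕ) := (hp.odd_of_ne_two hp2).pow
  haveI hfinH : Finite (galoisCohomology ((W.torsionGaloisModule ((p ^ 1 : ℕ) : ℤ)).toLocal (Sum.inr w₀ : Place K)) 1) :=
    Nat.finite_of_card_ne_zero (by rw [hH]; exact pow_ne_zero 2 hp.ne_zero)
  have hA : ∀ x : galoisCohomology ((W.torsionGaloisModule ((p ^ 1 : ℕ) : ℤ)).toLocal (Sum.inr w₀ : Place K)) 1,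
      (p ^ 1) • x = 0 :=
    nsmul_continuousCohomology_one_eq_zero _ (p ^ 1)
      (fun T : W.geomTorsion ((p ^ 1 : ℕ) : ℤ) ↦ AddSubgroup.torsionBy.nsmul T)
  -- the pairing at `w₀`: symmetric, non-degenerate
  have hsymm : ∀ x y, invWeilPairing W (p ^ 1) e hμ hadd₁ hadd₂ hgal inv (Sum.inr w₀) x y =
      invWeilPairing W (p ^ 1) e hμ hadd₁ hadd₂ hgal inv (Sum.inr w₀) y x :=
    fun x y ↦ invWeilPairing_symm W (p ^ 1) e hμ hadd₁ hadd₂ hgal halt inv _ x y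
  have hbij : Bijective (invWeilPairing W (p ^ 1) e hμ hadd₁ hadd₂ hgal inv (Sum.inr w₀)) :=
    invWeilPairing_bijective W (p ^ 1) e hμ hadd₁ hadd₂ hgal hnondeg inv w₀ (hperf w₀).1.1
  have hnd : ∀ x, (∀ y, invWeilPairing W (p ^ 1) e hμ hadd₁ hadd₂ hgal inv (Sum.inr w₀) x y = 0) → x = 0 :=
    fun x hx ↦ hbij.1 ((AddMonoidHom.ext hx).trans (map_zero _).symm)
  have hflip : Bijective (invWeilPairing W (p ^ 1) e hμ hadd₁ hadd₂ hgal inv (Sum.inr w₀)).flip := by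
    have h : (invWeilPairing W (p ^ 1) e hμ hadd₁ hadd₂ hgal inv (Sum.inr w₀)).flip =
        invWeilPairing W (p ^ 1) e hμ hadd₁ hadd₂ hgal inv (Sum.inr w₀) := by
      ext x y
      exact hsymm y x
    rw [h]
    exact hbij
  -- (1) the JUMP `[relaxed : strict] = p`
  have hle : (kummerStrict W (p ^ 1) {(Sum.inr w₀ : Place K)}).selmerGroup ≤
      (kummerRelaxed W (p ^ 1) {(Sum.inr w₀ : Place K)}).selmerGroup := fun x hx ↦ by
    rw [SelmerStructure.mem_selmerGroup_iff] at hx ⊢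
    exact fun v ↦ kummerStrict_le_kummerRelaxed W (p ^ 1) _ v (hx v)
  have hidx : (kummerStrict W (p ^ 1) {(Sum.inr w₀ : Place K)}).selmerGroup.relIndex
      (kummerRelaxed W (p ^ 1) {(Sum.inr w₀ : Place K)}).selmerGroup = p := by
    have h := relIndex_kummerStrict_kummerRelaxed_sq W p inv hp2 hperf hsum hcompl w₀
    rw [hH] at h
    exact Nat.pow_left_injective two_ne_zero h
  have hcardGF : Nat.card (kummerStrict W (p ^ 1) {(Sum.inr w₀ : Place K)}).selmerGroup * p =
      Nat.card (kummerRelaxed W (p ^ 1) {(Sum.inr w₀ : Place K)}).selmerGroup := by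
    have h : Nat.card (kummerStrict W (p ^ 1) {(Sum.inr w₀ : Place K)}).selmerGroup *
        (kummerStrict W (p ^ 1) {(Sum.inr w₀ : Place K)}).selmerGroup.relIndex
          (kummerRelaxed W (p ^ 1) {(Sum.inr w₀ : Place K)}).selmerGroup =
        Nat.card (kummerRelaxed W (p ^ 1) {(Sum.inr w₀ : Place K)}).selmerGroup := by
      rw [← Nat.card_congr (AddSubgroup.addSubgroupOfEquivOfLe hle).toEquiv]
      exact AddSubgroup.card_mul_index _
    rwa [hidx] at h
  -- (2) the image `Λ` at `w₀` of the relaxed group: order `p`, isotropic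
  have hFG := selmerGroup_kummerStrict_eq W (p ^ 1) (Sum.inr w₀ : Place K)
  have hΛcard : Nat.card ((kummerRelaxed W (p ^ 1) {(Sum.inr w₀ : Place K)}).selmerGroup.map
      (galoisCohomology.localization (W.torsionGaloisModule ((p ^ 1 : ℕ) : ℤ)) (Sum.inr w₀ : Place K) 1)) = p := by
    rw [natCard_map_eq_relIndex, ← hFG, hidx]
  have hΛiso : ∀ x ∈ (kummerRelaxed W (p ^ 1) {(Sum.inr w₀ : Place K)}).selmerGroup.map
      (galoisCohomology.localization (W.torsionGaloisModule ((p ^ 1 : ℕ) : ℤ)) (Sum.inr w₀ : Place K) 1),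
      ∀ y ∈ (kummerRelaxed W (p ^ 1) {(Sum.inr w₀ : Place K)}).selmerGroup.map
      (galoisCohomology.localization (W.torsionGaloisModule ((p ^ 1 : ℕ) : ℤ)) (Sum.inr w₀ : Place K) 1),
      invWeilPairing W (p ^ 1) e hμ hadd₁ hadd₂ hgal inv (Sum.inr w₀) x y = 0 := by
    rintro _ ⟨x, hx, rfl⟩ _ ⟨y, hy, rfl⟩
    exact invWeilPairing_localization_eq_zero_of_mem_relaxed W (p ^ 1) e hμ hadd₁ hadd₂ hgal halt inv hsum _ hx hy
  -- (3) the two given lines have order `p`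
  have hKiso : ∀ x ∈ W.kummerSelmerStructure ((p ^ 1 : ℕ) : ℤ) (Sum.inr w₀),
      ∀ y ∈ W.kummerSelmerStructure ((p ^ 1 : ℕ) : ℤ) (Sum.inr w₀),
      invWeilPairing W (p ^ 1) e hμ hadd₁ hadd₂ hgal inv (Sum.inr w₀) x y = 0 := fun x hx y hy ↦
    invWeilPairing_eq_zero_of_mem W (p ^ 1) e hμ hadd₁ hadd₂ hgal halt inv _ hx hy
  have hKcard : Nat.card (W.kummerSelmerStructure ((p ^ 1 : ℕ) : ℤ) (Sum.inr w₀)) = p := by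
    have h := natCard_annRight_mul hA _ hflip (W.kummerSelmerStructure ((p ^ 1 : ℕ) : ℤ) (Sum.inr w₀))
    rw [annRight_kummer_eq_of_odd W (p ^ 1) e hμ hadd₁ hadd₂ hgal halt hnondeg inv hp1 hodd hperf _, hH] at h
    have h' : Nat.card (W.kummerSelmerStructure ((p ^ 1 : ℕ) : ℤ) (Sum.inr w₀)) ^ 2 = p ^ 2 := by
      rw [sq]; exact h
    exact Nat.pow_left_injective two_ne_zero h'
  have hLcard : Nat.card L = p := by
    have hLle : L ≤ annRight (invWeilPairing W (p ^ 1) e hμ hadd₁ hadd₂ hgal inv (Sum.inr w₀)) L :=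
      fun y hy x hx ↦ hLiso x hx y hy
    have h := natCard_annRight_mul hA _ hflip L
    rw [hH] at h
    have hdvd : Nat.card L ∣ p ^ 2 := hH ▸ AddSubgroup.card_addSubgroup_dvd_card L
    obtain ⟨i, hi, hci⟩ := (Nat.dvd_prime_pow hp).mp hdvd
    interval_cases i
    · rw [pow_zero] at hci
      exact absurd (AddSubgroup.card_eq_one.mp hci) hL0
    · exact hci.trans (pow_one p)
    · exfalso
      have hle' : Nat.card L ≤ Nat.card (annRight (invWeilPairing W (p ^ 1) e hμ hadd₁ hadd₂ hgal inv (Sum.inr w₀)) L) :=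
        AddSubgroup.card_le_of_le hLle
      rw [hci] at h hle'
      have h1 : Nat.card (annRight (invWeilPairing W (p ^ 1) e hμ hadd₁ hadd₂ hgal inv (Sum.inr w₀)) L) = 1 :=
        Nat.eq_of_mul_eq_mul_right (pow_pos hp.pos 2) (h.trans (one_mul _).symm)
      rw [h1] at hle'
      have h2 : 1 < p ^ 2 := Nat.one_lt_pow two_ne_zero hp.one_lt
      omega
  -- (4) two isotropic lines carry every isotropic line: `Λ = 𝓚_{w₀}` or `Λ = L`
  haveI : Fact (p ^ 1).Prime := ⟨by rw [pow_one]; exact hp⟩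
  have hHq : Nat.card (galoisCohomology ((W.torsionGaloisModule ((p ^ 1 : ℕ) : ℤ)).toLocal (Sum.inr w₀ : Place K)) 1) =
      (p ^ 1) ^ 2 := hH.trans (by rw [pow_one])
  have hcases := eq_or_eq_of_isotropic_of_card_eq (by rw [pow_one]; exact hp2) hHq _ hsymm hnd
    (hΛcard.trans (pow_one p).symm) (hKcard.trans (pow_one p).symm) (hLcard.trans (pow_one p).symm)
    hΛiso hKiso hLiso hLK.symm
  -- (5) the two Selmer groups as cuts of the relaxed group
  have hSelK : (W.kummerSelmerStructure ((p ^ 1 : ℕ) : ℤ)).selmerGroup =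
      (kummerRelaxed W (p ^ 1) {(Sum.inr w₀ : Place K)}).selmerGroup ⊓
        (W.kummerSelmerStructure ((p ^ 1 : ℕ) : ℤ) (Sum.inr w₀)).comap
          (galoisCohomology.localization (W.torsionGaloisModule ((p ^ 1 : ℕ) : ℤ)) (Sum.inr w₀ : Place K) 1) := by
    have h := selmerGroup_update_eq W (p ^ 1) (Sum.inr w₀ : Place K)
      (W.kummerSelmerStructure ((p ^ 1 : ℕ) : ℤ) (Sum.inr w₀))
    rwa [Function.update_eq_self] at h
  have hSelL := selmerGroup_update_eq W (p ^ 1) (Sum.inr w₀ : Place K) L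
  have hKL : ∀ z, z ∈ W.kummerSelmerStructure ((p ^ 1 : ℕ) : ℤ) (Sum.inr w₀) → z ∈ L → z = 0 := fun z hzK hzL ↦ by
    by_contra hz
    exact hLK ((zmultiples_eq_of_card_eq_prime L hLcard hzL hz).symm.trans
      (zmultiples_eq_of_card_eq_prime _ hKcard hzK hz))
  rcases hcases with hΛ | hΛ
  · left
    rw [hSelK, hSelL, inf_comap_eq_self_of_map_eq _ _ hΛ, inf_comap_eq_inf_ker_of_map_eq _ _ hΛ hKL, ← hFG,
      ← hcardGF, Nat.mul_comm]
  · right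
    rw [hSelK, hSelL, inf_comap_eq_self_of_map_eq _ _ hΛ,
      inf_comap_eq_inf_ker_of_map_eq _ _ hΛ (fun z hzL hzK ↦ hKL z hzK hzL), ← hFG, ← hcardGF, Nat.mul_comm]

end Switch


/-! ## §5 (this file) Packaging: the switch from the NAMED Poitou–Tate fact; the PLANE count at `w₀ ∣ p`; the case `K = ℚ` -/

section Packaged

variable (p : ℕ) [Fact p.Prime]

/-- **The switch from the named Poitou–Tate fact.** Same statement as `natCard_selmerGroup_switch` with the family `inv` and
the Weil pairing `e` EXISTENTIALLY discharged (`poitouTate_selmerStructure_duality K` = DUAL.2 of the route, and the PROVED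
`exists_weilPairing_holds`); the isotropy of `L′` is then asked for every such family and pairing (for a transported Kummer
line it holds for all of them). [cite: PoonenRains2012, Prop. 4.11] [cite: MilneADT2006, Ch. I, Thm. 4.10] -/
theorem natCard_selmerGroup_switch_of_poitouTate (hp2 : p ≠ 2) (hPT : poitouTate_selmerStructure_duality K)
    (w₀ : HeightOneSpectrum (𝓞 K))
    (hH : Nat.card (galoisCohomology ((W.torsionGaloisModule ((p ^ 1 : ℕ) : ℤ)).toLocal (Sum.inr w₀ : Place K)) 1) = p ^ 2)
    (L : AddSubgroup (galoisCohomology ((W.torsionGaloisModule ((p ^ 1 : ℕ) : ℤ)).toLocal (Sum.inr w₀ : Place K)) 1))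
    (hLiso : ∀ [∀ v : Place K, CompactSpace (absoluteGaloisGroup (Place.Completion v))]
      (inv : LocalInvariants K (p ^ 1))
      (e : W.geomTorsion ((p ^ 1 : ℕ) : ℤ) → W.geomTorsion ((p ^ 1 : ℕ) : ℤ) → AlgebraicClosure K)
      (hμ : ∀ S T, e S T ^ (p ^ 1) = 1) (hadd₁ : ∀ S₁ S₂ T, e (S₁ + S₂) T = e S₁ T * e S₂ T)
      (hadd₂ : ∀ S T₁ T₂, e S (T₁ + T₂) = e S T₁ * e S T₂)
      (hgal : ∀ (σ : absoluteGaloisGroup K) (S T : W.geomTorsion ((p ^ 1 : ℕ) : ℤ)), σ • e S T = e (σ • S) (σ • T)),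
      inv.IsPerfect → (∀ T, e T T = 1) → (∀ T, (∀ S, e S T = 1) → T = 0) →
      ∀ x ∈ L, ∀ y ∈ L, invWeilPairing W (p ^ 1) e hμ hadd₁ hadd₂ hgal inv (Sum.inr w₀) x y = 0)
    (hL0 : L ≠ ⊥) (hLK : L ≠ W.kummerSelmerStructure ((p ^ 1 : ℕ) : ℤ) (Sum.inr w₀)) :
    Nat.card (W.kummerSelmerStructure ((p ^ 1 : ℕ) : ℤ)).selmerGroup =
        p * Nat.card (SelmerStructure.selmerGroup (Function.update (W.kummerSelmerStructure ((p ^ 1 : ℕ) : ℤ))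
          (Sum.inr w₀) L : SelmerStructure (W.torsionGaloisModule ((p ^ 1 : ℕ) : ℤ)))) ∨
      Nat.card (SelmerStructure.selmerGroup (Function.update (W.kummerSelmerStructure ((p ^ 1 : ℕ) : ℤ))
          (Sum.inr w₀) L : SelmerStructure (W.torsionGaloisModule ((p ^ 1 : ℕ) : ℤ)))) =
        p * Nat.card (W.kummerSelmerStructure ((p ^ 1 : ℕ) : ℤ)).selmerGroup := by
  have hp : p.Prime := Fact.out
  haveI : NeZero (p ^ 1 : ℕ) := ⟨pow_ne_zero 1 hp.ne_zero⟩
  haveI : PerfectField K := PerfectField.ofCharZero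
  haveI : ∀ v : Place K, CompactSpace (absoluteGaloisGroup (Place.Completion v)) := fun v ↦
    absoluteGaloisGroup_compactSpace _
  haveI : Finite (W.geomTorsion ((p ^ 1 : ℕ) : ℤ)) := finite_geomTorsion_of_neZero W (p ^ 1)
  obtain ⟨e, hμ, hadd₁, hadd₂, halt, hnondeg, hgal⟩ :=
    exists_weilPairing_holds W (p ^ 1) (by rw [pow_one]; exact hp.two_le) (by exact_mod_cast pow_ne_zero 1 hp.ne_zero)
  obtain ⟨inv, hperf, hsum, -, hcompl⟩ := hPT (p ^ 1)
  exact natCard_selmerGroup_switch W p e hμ hadd₁ hadd₂ hgal halt hnondeg inv hp2 hperf hsum hcompl w₀ hH L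
    (hLiso inv e hμ hadd₁ hadd₂ hgal hperf halt hnondeg) hL0 hLK

/-- **(A1)-shape corollary: equal parity FORCES the lines to coincide.** In the situation of
`natCard_selmerGroup_switch_of_poitouTate` (odd `p`, the named Poitou–Tate fact, a PLANE at `w₀`, `L′` isotropic for every
family ∕ Weil pairing and non-zero), if the Selmer groups of `𝓚` and of `𝓚[w₀ ↦ L′]` have orders `p^a`, `p^b` with `a ≡ b (mod 2)`
— for a transfer line: `p`-parity for `E` and for the lender plus equal global root numbers — then `L′` IS E's Kummer condition at
`w₀`. (Contrapositive of the switch: otherwise the orders differ by exactly one factor `p`.) [cite: PoonenRains2012, Prop. 4.11]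
[cite: DokchitserDokchitserAnnals2010, Thm. 1.4] -/
theorem eq_kummer_of_isotropic_of_even_iff (hp2 : p ≠ 2) (hPT : poitouTate_selmerStructure_duality K)
    (w₀ : HeightOneSpectrum (𝓞 K))
    (hH : Nat.card (galoisCohomology ((W.torsionGaloisModule ((p ^ 1 : ℕ) : ℤ)).toLocal (Sum.inr w₀ : Place K)) 1) = p ^ 2)
    (L : AddSubgroup (galoisCohomology ((W.torsionGaloisModule ((p ^ 1 : ℕ) : ℤ)).toLocal (Sum.inr w₀ : Place K)) 1))
    (hLiso : ∀ [∀ v : Place K, CompactSpace (absoluteGaloisGroup (Place.Completion v))]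
      (inv : LocalInvariants K (p ^ 1))
      (e : W.geomTorsion ((p ^ 1 : ℕ) : ℤ) → W.geomTorsion ((p ^ 1 : ℕ) : ℤ) → AlgebraicClosure K)
      (hμ : ∀ S T, e S T ^ (p ^ 1) = 1) (hadd₁ : ∀ S₁ S₂ T, e (S₁ + S₂) T = e S₁ T * e S₂ T)
      (hadd₂ : ∀ S T₁ T₂, e S (T₁ + T₂) = e S T₁ * e S T₂)
      (hgal : ∀ (σ : absoluteGaloisGroup K) (S T : W.geomTorsion ((p ^ 1 : ℕ) : ℤ)), σ • e S T = e (σ • S) (σ • T)),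
      inv.IsPerfect → (∀ T, e T T = 1) → (∀ T, (∀ S, e S T = 1) → T = 0) →
      ∀ x ∈ L, ∀ y ∈ L, invWeilPairing W (p ^ 1) e hμ hadd₁ hadd₂ hgal inv (Sum.inr w₀) x y = 0)
    (hL0 : L ≠ ⊥)
    (hpar : ∃ a b : ℕ, Nat.card (W.kummerSelmerStructure ((p ^ 1 : ℕ) : ℤ)).selmerGroup = p ^ a ∧
      Nat.card (SelmerStructure.selmerGroup (Function.update (W.kummerSelmerStructure ((p ^ 1 : ℕ) : ℤ))
          (Sum.inr w₀) L : SelmerStructure (W.torsionGaloisModule ((p ^ 1 : ℕ) : ℤ)))) = p ^ b ∧ (Even a ↔ Even b)) :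
    L = W.kummerSelmerStructure ((p ^ 1 : ℕ) : ℤ) (Sum.inr w₀) := by
  have hp : p.Prime := Fact.out
  by_contra hLK
  obtain ⟨a, b, ha, hb, hab⟩ := hpar
  have hinj : ∀ {m n : ℕ}, p ^ m = p ^ n → m = n := fun h ↦ Nat.pow_right_injective hp.two_le h
  rcases natCard_selmerGroup_switch_of_poitouTate W p hp2 hPT w₀ hH L hLiso hL0 hLK with h | h
  · rw [ha, hb, ← pow_succ'] at h
    have hab' : a = b + 1 := hinj h
    rw [hab', Nat.even_add_one] at hab
    exact (not_iff_self hab).elim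
  · rw [ha, hb, ← pow_succ'] at h
    have hab' : b = a + 1 := hinj h
    rw [hab', Nat.even_add_one] at hab
    exact (iff_not_self hab).elim

/-- **The PLANE count.** At a finite place `v` with `E(K_v)[p] = 0` and residue extension `#(𝓞_v / p) = p` (e.g. `K = ℚ`,
`v = (p)`), `#H¹(K_v, E[p]) = p²` — Tate's local Euler–Poincaré characteristic `#H¹ = (#E(K_v)[p] · #(𝓞_v/p))²` (tree
`natCard_galoisCohomology_one_torsion_adicCompletion_eq_sq` with the PROVED `localEulerPoincareCharacteristic_holds`).
[cite: MilneADT2006, Ch. I, Thm. 2.8 and Lemma 3.3] -/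
theorem natCard_localH1_eq_sq (v : HeightOneSpectrum (𝓞 K))
    (htors : ∀ P : (W.baseChange (v.adicCompletion K)).toAffine.Point, (p ^ 1) • P = 0 → P = 0)
    (hres : Nat.card (v.adicCompletionIntegers K ⧸ Ideal.span {((p ^ 1 : ℕ) : v.adicCompletionIntegers K)}) = p) :
    Nat.card (galoisCohomology ((W.torsionGaloisModule ((p ^ 1 : ℕ) : ℤ)).toLocal (Sum.inr v : Place K)) 1) = p ^ 2 := by
  have hp : p.Prime := Fact.out
  haveI : NeZero (p ^ 1 : ℕ) := ⟨pow_ne_zero 1 hp.ne_zero⟩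
  have hp1 : IsPrimePow (p ^ 1 : ℕ) := hp.isPrimePow.pow one_ne_zero
  have hEP : localEulerPoincareCharacteristic (v.adicCompletion K) := by
    haveI : CharZero (v.adicCompletion K) := charZero_of_injective_algebraMap (algebraMap K _).injective
    exact localEulerPoincareCharacteristic_holds (v.adicCompletion K)
  have hker : Nat.card (nsmulAddMonoidHom (p ^ 1) :
      (W.baseChange (v.adicCompletion K)).toAffine.Point →+ _).ker = 1 := by
    rw [AddSubgroup.card_eq_one, AddSubgroup.eq_bot_iff_forall]
    intro P hP
    rw [AddMonoidHom.mem_ker, nsmulAddMonoidHom_apply] at hP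
    exact htors P hP
  have h := natCard_galoisCohomology_one_torsion_adicCompletion_eq_sq W v (p ^ 1) hp1 hEP
  rw [hker, hres, one_mul] at h
  exact h

/-- **The plane count over `ℚ`**: for `E/ℚ` and the place `v = (p)`, `E(ℚ_p)[p] = 0 ⟹ #H¹(ℚ_p, E[p]) = p²` (`#(ℤ_p/p) = p`,
tree `natCard_quot_adicCompletionIntegers_of_prime_mem`). The binder `E(ℚ_p)[p] = 0` is automatic off the Kodaira types II
(at `5, 7`) and III (at `5`) on additive cells and decidable per curve (TRIAGE-r1-2 (G3-4), Q-LOC5T).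
[cite: MilneADT2006, Ch. I, Thm. 2.8 and Lemma 3.3] -/
theorem natCard_localH1_rat_eq_sq (V : WeierstrassCurve ℚ) [V.IsElliptic] (v : HeightOneSpectrum (𝓞 ℚ))
    (hv : ((p : ℕ) : 𝓞 ℚ) ∈ v.asIdeal)
    (htors : ∀ P : (V.baseChange (v.adicCompletion ℚ)).toAffine.Point, (p ^ 1) • P = 0 → P = 0) :
    Nat.card (galoisCohomology ((V.torsionGaloisModule ((p ^ 1 : ℕ) : ℤ)).toLocal (Sum.inr v : Place ℚ)) 1) = p ^ 2 :=
  natCard_localH1_eq_sq V p v htors (by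
    rw [pow_one]
    exact natCard_quot_adicCompletionIntegers_of_prime_mem p hv)

end Packaged

end Summit.BirchSwinnertonDyer.BirchSwinnertonDyer.Theorems.AdditiveKoly.LagrangianSwitchAtP

end
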